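import Literature.MathematicalPhysics.QuantumFieldTheory.Balaban1983to89.T4HistoryLipschitzLinearSize

/-!
# T4LinearSizeSharpLower — the sharp lower half of Bałaban's (2.30): `#X ≤ 2^ν + 2^{ν−1}·d(X)`

[II] = T. Bałaban, *Renormalization group approach to lattice gauge field theories. II. Cluster expansions*, Commun.
Math. Phys. **116** (1988) 1–22, states on p.18, for the linear size `d_k(Y)` of [I] (T. Bałaban, Commun. Math. Phys.
**109** (1987) 249–301, p.257) of a localization domain `Y` made of `M⁻⁴|Y|` big cubes,

  (2.30) «(3·2³)⁻¹M⁻⁴|Y| ≤ d_k(Y) ≤ M⁻⁴|Y| − 1»,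

(also (1.28) p.8 «M⁻⁴|Y| ≤ 3·2³d_k(Y)»).  The sibling leaf `T4HistoryLipschitzLinearSize` (lineage t4-ne9-p2; imported
BY NAME, not edited) formalises `d` in its lattice-edge form `linSize` (a LATTICE SKELETON `S` of the cube family `X` is
an `EdgeAdj X`-connected set of lattice points containing a corner of every cube; `linSize X = min #S − 1`), proves
the upper half for every wall-connected family (`linSize_le_card_sub_one`), shows that the lower half AS PRINTED fails
for families of linear size `0` (`not_printedLower_singleton`) and proves the corrected `#X ≤ 2^ν·(d(X)+1)`
(`card_le_two_pow_mul_linSize_succ`), whence the printed form for `#X ≥ 48` on T⁴ (`printedLower_of_card_ge`).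

THIS LEAF sharpens the count: walking a lattice skeleton from a root, the root is a corner of at most `2^ν` cubes, and
every further skeleton point `r = c ± e_i`, reached along a cube edge from `c`, is a corner of at most `2^{ν−1}` cubes
that do not already have `c` as a corner (the cubes cornered at `r = c + e_i` are `r − cornerVec ε`; those with
`i ∈ ε` are `c − cornerVec (ε∖{i})`, cornered at `c`; so the new ones are indexed by `{ε : i ∉ ε}` — and symmetrically for
`r = c − e_i` by `{ε : i ∈ ε}`).  Hence

* `card_le_two_pow_add_mul_linSize`: **`#X ≤ 2^ν + 2^{ν−1}·d(X)`** for every cube family with a lattice skeleton, over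
  any coordinate group `G` (torus `ZMod N`, lattice `ℤ`); on T⁴: `M⁻⁴|Y| ≤ 16 + 8·d_k(Y)` (`card_le_sixteen_add_eight_mul`);
* `printedLower_of_linSize_pos`: **the PRINTED lower half of (2.30), with its printed constant `3·2³`, holds for EVERY
  family of POSITIVE linear size** on a four-dimensional lattice (`16 + 8d ≤ 24d ⟺ d ≥ 1`), and
  `printedLower_of_card_gt_sixteen`: for every family of more than `2⁴ = 16` cubes (a family of linear size `0` has a
  common corner, hence at most `2^ν` cubes: `card_le_two_pow_of_linSize_eq_zero`).  Print restricts its sums to domains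
  with `d_k ≠ 0` ([II] p.8, after (1.26): «we sum over X with d_j(X) ≠ 0, as it follows from our inductive
  construction»), and its localization domains contain the block `□̃⁴`, the cube of size `(1+2·4)M` of [I] p.257; so
  within print's scope (2.30) holds VERBATIM, and the only failures of the printed lower half are the families of linear
  size `0` (all cubes sharing one corner).  The constant is SHARP at `d = 1`: the `24 = 3·2³` unit cubes of `ℤ⁴` having
  an endpoint of the edge `[0, e₀]` as a corner form a family of linear size `≤ 1` with `#X = 24`
  (`card_edgeStar`, `linSize_edgeStar`, `card_edgeStar_eq : #edgeStar = 3·2³·d(edgeStar)`);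
* `exp_neg_mul_linSize_le_sharp`: the decay conversion `e^{−a·d(X)} ≤ e^{2a}·(e^{−a/2^{ν−1}})^{#X}` (rate `a/2^{ν−1}` per
  cube, twice the rate of `T4HistoryLipschitzLinearSize.exp_neg_mul_linSize_le`).

The combinatorial engine is an abstract COVER LEMMA (`card_biUnion_sdiff_le`): if finite tiles `f c` are attached to
the points of a set `S` connected from `a` (`Polymer.IsConn adj S a`) and along every step `adj c r` the tile of `r`
has at most `B` cells outside the tile of `c`, then `#(⋃_{c∈S} f c ∖ f a) ≤ B·(#S − 1)` — by strong induction over the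
components (`Polymer.comps`) of `S ∖ {a}`, each of which contains a neighbour of `a` (`Polymer.Reach.exists_adj_reach_erase`).

Honest scope.  One-scale lattice combinatorics only (finite families of unit cubes given by their lower corners in
`Fin ν → G`); `linSize` is the lattice-edge form of `d` (the continuum Steiner form of [I] p.257 can be smaller — see the
header of `T4HistoryLipschitzLinearSize`); nothing printed is used as a hypothesis; no claim about [I]–[III]'s analytic
estimates, infinite volume, the continuum or a mass gap.  All results kernel-checked, no `sorry`.

References (TYPE pointers only): [Balaban1988RG2Cluster] (2.30) p.18, (1.28) p.8, the sentence after (1.26) p.8;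
[Balaban1987RG1] p.257 (linear size; «□̃ⁿ as a cube of the size (1+2n)M»).
-/

namespace Literature.MathematicalPhysics.QuantumFieldTheory.Balaban1983to89.T4LinearSizeSharpLower

open scoped BigOperators
open Literature.MathematicalPhysics.QuantumFieldTheory
open Literature.MathematicalPhysics.QuantumFieldTheory.Balaban1983to89.T4HistoryLipschitzLinearSize

/-! ## §1 The cover lemma along a connected set -/

section Cover

variable {α β : Type*} [DecidableEq α] [DecidableEq β] {adj : α → α → Prop}

/-- In a set `S` connected from `a`, every component of `S ∖ {a}` contains a neighbour `t` of `a` and is connected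
from `t` (last-exit decomposition of a chain from `a`). [folklore] -/
theorem exists_adj_isConn_of_mem_comps [Std.Symm adj] {S : Finset α} {a : α} (hS : Polymer.IsConn adj S a)
    {K : Finset α} (hK : K ∈ Polymer.comps adj (S.erase a) (S.erase a)) :
    ∃ t ∈ K, adj a t ∧ Polymer.IsConn adj K t := by
  obtain ⟨b, hb, rfl⟩ := Polymer.mem_comps.1 hK
  have hba : b ≠ a := (Finset.mem_erase.1 hb).1
  obtain ⟨t, ht, hat, htb⟩ := (hS.reach (Finset.mem_of_mem_erase hb)).exists_adj_reach_erase hba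
  have htK : t ∈ Polymer.comp adj (S.erase a) b := Polymer.mem_comp.2 ⟨ht, htb.symm⟩
  refine ⟨t, htK, hat, ?_⟩
  rw [← Polymer.comp_eq_of_mem htK]
  exact Polymer.isConn_comp ht

/-- **COVER LEMMA.**  Tiles `f c` attached to the points of a set `S` connected from `a`; if along every step `adj c r`
the tile of `r` has at most `B` cells outside the tile of `c`, then all the tiles together have at most `B·(#S − 1)`
cells outside the root tile: `#(⋃_{c∈S} f c ∖ f a) ≤ B·(#S − 1)`.  (Strong induction: split `S ∖ {a}` into its
components; each contains a neighbour `t` of `a`, contributes `#(f t ∖ f a) ≤ B` plus, by induction from `t`, at most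
`B·(#K − 1)`.) [folklore] -/
theorem card_biUnion_sdiff_le [Std.Symm adj] (f : α → Finset β) {B : ℕ} (hB : ∀ c r, adj c r → (f r \ f c).card ≤ B) :
    ∀ (S : Finset α) (a : α), Polymer.IsConn adj S a → (S.biUnion f \ f a).card ≤ B * (S.card - 1) := by
  intro S
  induction S using Finset.strongInduction with
  | H S ih =>
  intro a hS
  set Q := S.erase a with hQ
  have hcov : ∀ b ∈ Q, ∃ t ∈ Q, Polymer.Reach adj Q t b := fun b hb => ⟨b, hb, Polymer.Reach.refl b⟩
  have hsub : S.biUnion f \ f a ⊆ (Polymer.comps adj Q Q).biUnion fun K => K.biUnion f \ f a := by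
    intro x hx
    rw [Finset.mem_sdiff, Finset.mem_biUnion] at hx
    obtain ⟨⟨c, hcS, hxc⟩, hxa⟩ := hx
    have hca : c ≠ a := by rintro rfl; exact hxa hxc
    have hcQ : c ∈ Q := Finset.mem_erase.2 ⟨hca, hcS⟩
    refine Finset.mem_biUnion.2 ⟨Polymer.comp adj Q c, Polymer.mem_comps.2 ⟨c, hcQ, rfl⟩, ?_⟩
    exact Finset.mem_sdiff.2 ⟨Finset.mem_biUnion.2 ⟨c, Polymer.mem_comp_self.2 hcQ, hxc⟩, hxa⟩
  have hK : ∀ K ∈ Polymer.comps adj Q Q, (K.biUnion f \ f a).card ≤ B * K.card := by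
    intro K hK
    obtain ⟨t, htK, hat, hKt⟩ := exists_adj_isConn_of_mem_comps hS hK
    have hKQ : K ⊆ Q := Polymer.subset_of_mem_comps hK
    have hKS : K ⊂ S := by
      refine Finset.ssubset_iff_subset_ne.2 ⟨hKQ.trans (Finset.erase_subset a S), ?_⟩
      rintro rfl
      exact (Finset.mem_erase.1 (hKQ hS.mem)).1 rfl
    have ih' := ih K hKS t hKt
    have hsub' : K.biUnion f \ f a ⊆ (f t \ f a) ∪ (K.biUnion f \ f t) := by
      intro x hx
      rw [Finset.mem_sdiff] at hx
      by_cases hxt : x ∈ f t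
      · exact Finset.mem_union_left _ (Finset.mem_sdiff.2 ⟨hxt, hx.2⟩)
      · exact Finset.mem_union_right _ (Finset.mem_sdiff.2 ⟨hx.1, hxt⟩)
    have hpos : 1 ≤ K.card := hKt.card_pos
    calc (K.biUnion f \ f a).card ≤ ((f t \ f a) ∪ (K.biUnion f \ f t)).card := Finset.card_le_card hsub'
      _ ≤ (f t \ f a).card + (K.biUnion f \ f t).card := Finset.card_union_le _ _
      _ ≤ B + B * (K.card - 1) := Nat.add_le_add (hB a t hat) ih'
      _ = B * K.card := by
        obtain ⟨k, hk⟩ : ∃ k, K.card = k + 1 := ⟨K.card - 1, by omega⟩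
        rw [hk, Nat.add_sub_cancel]; ring
  calc (S.biUnion f \ f a).card ≤ ((Polymer.comps adj Q Q).biUnion fun K => K.biUnion f \ f a).card :=
        Finset.card_le_card hsub
    _ ≤ ∑ K ∈ Polymer.comps adj Q Q, (K.biUnion f \ f a).card := Finset.card_biUnion_le
    _ ≤ ∑ K ∈ Polymer.comps adj Q Q, B * K.card := Finset.sum_le_sum hK
    _ = B * Q.card := by rw [← Finset.mul_sum, ← Polymer.card_eq_sum_card_comps (subset_refl Q) hcov]
    _ = B * (S.card - 1) := by rw [hQ, Finset.card_erase_of_mem hS.mem]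

end Cover

/-! ## §2 Cubes cornered at a lattice point; the `2^{ν−1}` new cubes along a cube edge -/

section Geometry

variable {ν : ℕ} {G : Type*} [AddCommGroup G] [One G] [DecidableEq G]

/-- the (at most `2^ν`) unit lattice cubes, given by their lower corners `c − cornerVec ε`, having the lattice point
`c` as a corner. [cite: Balaban1987RG1, p.257] -/
def cubesAt (c : Fin ν → G) : Finset (Fin ν → G) :=
  (Finset.univ : Finset (Finset (Fin ν))).image fun ε => c - cornerVec ε

/-- a cube having `c` as a corner is one of the cubes cornered at `c`. [folklore] -/
theorem mem_cubesAt_of_isCorner {m c : Fin ν → G} (h : IsCorner m c) : m ∈ cubesAt c := by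
  obtain ⟨ε, rfl⟩ := h
  exact Finset.mem_image.2 ⟨ε, Finset.mem_univ _, by abel⟩

/-- conversely every cube cornered at `c` has `c` as a corner. [folklore] -/
theorem isCorner_of_mem_cubesAt {m c : Fin ν → G} (h : m ∈ cubesAt c) : IsCorner m c := by
  obtain ⟨ε, -, rfl⟩ := Finset.mem_image.1 h
  exact ⟨ε, by abel⟩

/-- at most `2^ν` cubes are cornered at a lattice point. [folklore] -/
theorem card_cubesAt_le (c : Fin ν → G) : (cubesAt c).card ≤ 2 ^ ν :=
  Finset.card_image_le.trans (by rw [Finset.card_univ, Fintype.card_finset, Fintype.card_fin])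

/-- the coordinate subsets avoiding a fixed direction `i` number `2^{ν−1}`. [folklore] -/
theorem card_powerset_univ_erase (i : Fin ν) :
    ((Finset.univ : Finset (Fin ν)).erase i).powerset.card = 2 ^ (ν - 1) := by
  rw [Finset.card_powerset, Finset.card_erase_of_mem (Finset.mem_univ i), Finset.card_univ, Fintype.card_fin]

/-- **ALONG A CUBE EDGE AT MOST `2^{ν−1}` NEW CUBES.**  If `r = c ± e_i`, the cubes cornered at `r` but NOT at `c` number
at most `2^{ν−1}`: for `r = c + e_i` the cube `r − cornerVec ε` with `i ∈ ε` equals `c − cornerVec (ε∖{i})`, so new cubes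
have `i ∉ ε`; for `r = c − e_i` the cube `r − cornerVec ε` with `i ∉ ε` equals `c − cornerVec (ε ∪ {i})`, so new cubes have
`i ∈ ε`. [folklore] -/
theorem card_cubesAt_sdiff_le {c r : Fin ν → G} {i : Fin ν} (h : r = c + Pi.single i 1 ∨ c = r + Pi.single i 1) :
    (cubesAt r \ cubesAt c).card ≤ 2 ^ (ν - 1) := by
  classical
  set P := ((Finset.univ : Finset (Fin ν)).erase i).powerset with hP
  have hPmem : ∀ ε : Finset (Fin ν), i ∉ ε → ε ∈ P := fun ε hε =>
    Finset.mem_powerset.2 fun j hj => Finset.mem_erase.2 ⟨by rintro rfl; exact hε hj, Finset.mem_univ j⟩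
  rcases h with h | h
  · have hsub : cubesAt r \ cubesAt c ⊆ P.image fun ε => r - cornerVec ε := by
      intro x hx
      obtain ⟨hxr, hxc⟩ := Finset.mem_sdiff.1 hx
      obtain ⟨ε, -, rfl⟩ := Finset.mem_image.1 hxr
      by_cases hi : i ∈ ε
      · exact (hxc (Finset.mem_image.2 ⟨ε.erase i, Finset.mem_univ _, by
          rw [h, cornerVec_eq_erase_add hi]; abel⟩)).elim
      · exact Finset.mem_image.2 ⟨ε, hPmem ε hi, rfl⟩
    calc (cubesAt r \ cubesAt c).card ≤ (P.image fun ε => r - cornerVec ε).card := Finset.card_le_card hsub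
      _ ≤ P.card := Finset.card_image_le
      _ = 2 ^ (ν - 1) := card_powerset_univ_erase i
  · have hsub : cubesAt r \ cubesAt c ⊆ P.image fun ε => r - Pi.single i 1 - cornerVec ε := by
      intro x hx
      obtain ⟨hxr, hxc⟩ := Finset.mem_sdiff.1 hx
      obtain ⟨ε, -, rfl⟩ := Finset.mem_image.1 hxr
      by_cases hi : i ∈ ε
      · exact Finset.mem_image.2 ⟨ε.erase i, hPmem _ (Finset.notMem_erase i ε), by
          rw [cornerVec_eq_erase_add hi]; abel⟩
      · exact (hxc (Finset.mem_image.2 ⟨insert i ε, Finset.mem_univ _, by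
          rw [h, cornerVec_insert hi]; abel⟩)).elim
    calc (cubesAt r \ cubesAt c).card ≤ (P.image fun ε => r - Pi.single i 1 - cornerVec ε).card :=
        Finset.card_le_card hsub
      _ ≤ P.card := Finset.card_image_le
      _ = 2 ^ (ν - 1) := card_powerset_univ_erase i

/-! ## §3 The sharp count `#X ≤ 2^ν + 2^{ν−1}·d(X)` and the printed lower half of (2.30) for `d ≥ 1` -/

/-- **`#X ≤ 2^ν + 2^{ν−1}·(#S − 1)` FOR A LATTICE SKELETON `S` OF `X`**: the cover lemma with the tiles `cubesAt`, root any
point of `S`, step bound `card_cubesAt_sdiff_le` along the cube edges of the skeleton. [folklore] -/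
theorem card_le_of_isSkeleton {X S : Finset (Fin ν → G)} (h : IsSkeleton X S) :
    X.card ≤ 2 ^ ν + 2 ^ (ν - 1) * (S.card - 1) := by
  classical
  obtain ⟨⟨a, -, hconn⟩, hcov⟩ := h
  have hB : ∀ c r, EdgeAdj X c r → (cubesAt r \ cubesAt c).card ≤ 2 ^ (ν - 1) := by
    intro c r hcr
    obtain ⟨i, hi⟩ := exists_single_of_edgeAdj hcr
    exact card_cubesAt_sdiff_le hi
  have hXsub : X ⊆ S.biUnion cubesAt := fun m hm => by
    obtain ⟨c, hc, hmc⟩ := hcov m hm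
    exact Finset.mem_biUnion.2 ⟨c, hc, mem_cubesAt_of_isCorner hmc⟩
  have hsplit : S.biUnion cubesAt ⊆ cubesAt a ∪ (S.biUnion cubesAt \ cubesAt a) := by
    intro x hx
    by_cases hxa : x ∈ cubesAt a
    · exact Finset.mem_union_left _ hxa
    · exact Finset.mem_union_right _ (Finset.mem_sdiff.2 ⟨hx, hxa⟩)
  calc X.card ≤ (S.biUnion cubesAt).card := Finset.card_le_card hXsub
    _ ≤ (cubesAt a ∪ (S.biUnion cubesAt \ cubesAt a)).card := Finset.card_le_card hsplit
    _ ≤ (cubesAt a).card + (S.biUnion cubesAt \ cubesAt a).card := Finset.card_union_le _ _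
    _ ≤ 2 ^ ν + 2 ^ (ν - 1) * (S.card - 1) :=
        Nat.add_le_add (card_cubesAt_le a) (card_biUnion_sdiff_le cubesAt hB S a hconn)

/-- **THE SHARP LOWER HALF OF (2.30) (kernel): `#X ≤ 2^ν + 2^{ν−1}·d(X)`** for every cube family with a lattice skeleton
(e.g. a wall-connected one, `T4HistoryLipschitzLinearSize.isSkeleton_self_of_isConn`), over any coordinate group.
[II] (2.30) p.18 prints «(3·2³)⁻¹M⁻⁴|Y| ≤ d_k(Y)», i.e. `#X ≤ 24·d` on T⁴; here `#X ≤ 16 + 8·d`, which is `≤ 24·d` iff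
`d ≥ 1` (`printedLower_of_linSize_pos`). [cite: Balaban1988RG2Cluster, (2.30) p.18] -/
theorem card_le_two_pow_add_mul_linSize {X : Finset (Fin ν → G)} (h : ∃ S, IsSkeleton X S) :
    X.card ≤ 2 ^ ν + 2 ^ (ν - 1) * linSize X := by
  obtain ⟨S, hS, hcard⟩ := exists_isSkeleton_card_eq h
  have := card_le_of_isSkeleton hS
  rwa [hcard, Nat.add_sub_cancel] at this

/-- **A FAMILY OF LINEAR SIZE `0` HAS AT MOST `2^ν` CUBES** (they share a corner). [folklore] -/
theorem card_le_two_pow_of_linSize_eq_zero {X : Finset (Fin ν → G)} (h : ∃ S, IsSkeleton X S) (h0 : linSize X = 0) :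
    X.card ≤ 2 ^ ν := by
  have := card_le_two_pow_add_mul_linSize h
  rwa [h0, mul_zero, add_zero] at this

/-- on a four-dimensional lattice: `#X ≤ 16 + 8·d(X)`. [cite: Balaban1988RG2Cluster, (2.30) p.18] -/
theorem card_le_sixteen_add_eight_mul {G : Type*} [AddCommGroup G] [One G] [DecidableEq G] {X : Finset (Fin 4 → G)}
    (h : ∃ S, IsSkeleton X S) : X.card ≤ 16 + 8 * linSize X := by
  simpa using card_le_two_pow_add_mul_linSize h

/-- **THE PRINTED LOWER HALF OF (2.30) FOR EVERY FAMILY OF POSITIVE LINEAR SIZE (kernel)**: on a four-dimensional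
lattice, `(3·2³)⁻¹·#X ≤ d(X)` as soon as `d(X) ≥ 1` — [II] (2.30) p.18 «(3·2³)⁻¹M⁻⁴|Y| ≤ d_k(Y)» / (1.28) p.8
«M⁻⁴|Y| ≤ 3·2³d_k(Y)» with the PRINTED constant; print sums only over domains with `d_k ≠ 0` (p.8, after (1.26): «we sum
over X with d_j(X) ≠ 0»).  The only failures of the printed form are the families of linear size `0`
(`T4HistoryLipschitzLinearSize.not_printedLower_singleton`). [cite: Balaban1988RG2Cluster, (2.30) p.18, (1.28) p.8] -/
theorem printedLower_of_linSize_pos {G : Type*} [AddCommGroup G] [One G] [DecidableEq G] {X : Finset (Fin 4 → G)}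
    (h : ∃ S, IsSkeleton X S) (hd : 1 ≤ linSize X) :
    (3 * 2 ^ 3 : ℝ)⁻¹ * (X.card : ℝ) ≤ (linSize X : ℝ) := by
  have h1 : (X.card : ℝ) ≤ 16 + 8 * (linSize X : ℝ) := by exact_mod_cast card_le_sixteen_add_eight_mul h
  have h2 : (1 : ℝ) ≤ linSize X := by exact_mod_cast hd
  norm_num at h1 ⊢
  linarith

/-- **THE PRINTED LOWER HALF OF (2.30) FOR EVERY FAMILY OF MORE THAN `2⁴ = 16` CUBES (kernel)** — in particular for
print's localization domains, which contain the block `□̃⁴` of `9⁴` big cubes ([I] p.257, [II] (1.9)–(1.10) p.4): a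
family with more than `2^ν` cubes has positive linear size. [cite: Balaban1988RG2Cluster, (2.30) p.18] -/
theorem printedLower_of_card_gt_sixteen {G : Type*} [AddCommGroup G] [One G] [DecidableEq G] {X : Finset (Fin 4 → G)}
    (h : ∃ S, IsSkeleton X S) (h16 : 16 < X.card) :
    (3 * 2 ^ 3 : ℝ)⁻¹ * (X.card : ℝ) ≤ (linSize X : ℝ) := by
  refine printedLower_of_linSize_pos h ?_
  by_contra hd
  have h0 : linSize X = 0 := by omega
  have := card_le_two_pow_of_linSize_eq_zero h h0
  norm_num at this
  omega

/-- `2^ν ≤ 2·2^{ν−1}` (equality for `ν ≥ 1`). [folklore] -/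
theorem two_pow_le_two_mul_two_pow_pred (ν : ℕ) : 2 ^ ν ≤ 2 * 2 ^ (ν - 1) := by
  cases ν with
  | zero => norm_num
  | succ n => rw [pow_succ, Nat.add_sub_cancel]; omega

/-- **SHARP DECAY CONVERSION (kernel): `e^{−a·d(X)} ≤ e^{2a}·(e^{−a/2^{ν−1}})^{#X}`** for `0 ≤ a` and `X` with a lattice
skeleton — decay in the linear size is decay in the number of cubes at rate `a/2^{ν−1}` per cube (the conversion made
after (2.29) p.18 with (2.30); cf. `T4HistoryLipschitzLinearSize.exp_neg_mul_linSize_le`, rate `a/2^ν`).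
[cite: Balaban1988RG2Cluster, (2.30) p.18] -/
theorem exp_neg_mul_linSize_le_sharp {X : Finset (Fin ν → G)} {a : ℝ} (ha : 0 ≤ a) (h : ∃ S, IsSkeleton X S) :
    Real.exp (-(a * (linSize X : ℝ))) ≤ Real.exp (2 * a) * Real.exp (-(a / 2 ^ (ν - 1))) ^ X.card := by
  have h1 : (X.card : ℝ) ≤ 2 ^ ν + 2 ^ (ν - 1) * (linSize X : ℝ) := by
    exact_mod_cast card_le_two_pow_add_mul_linSize h
  have hq : (2 : ℝ) ^ ν ≤ 2 * 2 ^ (ν - 1) := by exact_mod_cast two_pow_le_two_mul_two_pow_pred ν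
  have hp : (0 : ℝ) < 2 ^ (ν - 1) := pow_pos two_pos _
  set p : ℝ := 2 ^ (ν - 1) with hp_def
  have hc : (X.card : ℝ) ≤ 2 * p + p * (linSize X : ℝ) := by linarith
  have ht : 0 ≤ a / p := div_nonneg ha hp.le
  have hkey : a / p * (X.card : ℝ) ≤ a / p * (2 * p + p * (linSize X : ℝ)) := mul_le_mul_of_nonneg_left hc ht
  have hid : a / p * (2 * p + p * (linSize X : ℝ)) = 2 * a + a * (linSize X : ℝ) := by
    calc a / p * (2 * p + p * (linSize X : ℝ)) = a * (2 + (linSize X : ℝ)) * (p / p) := by ring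
      _ = 2 * a + a * (linSize X : ℝ) := by rw [div_self hp.ne']; ring
  rw [← Real.exp_nat_mul, ← Real.exp_add]
  exact Real.exp_le_exp.2 (by linarith)

end Geometry

/-! ## §4 Sharpness at `d = 1`: the `24 = 3·2³` cubes of `ℤ⁴` around one lattice edge -/

section Sharp

/-- the EDGE STAR: the unit cubes of `ℤ⁴` having an endpoint of the lattice edge `[0, e₀]` as a corner. [folklore] -/
def edgeStar : Finset (Fin 4 → ℤ) := cubesAt (0 : Fin 4 → ℤ) ∪ cubesAt (ue 0)

/-- the edge star has exactly `24 = 3·2³` cubes (a `3×2×2×2` box). [folklore] -/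
theorem card_edgeStar : edgeStar.card = 24 := by
  decide

/-- the two endpoints `{0, e₀}` of the edge form a lattice skeleton of the edge star (the edge `[0, e₀]` is an edge of
the cube `0 ∈ edgeStar`; every cube of the star has `0` or `e₀` as a corner). [folklore] -/
theorem isSkeleton_edgeStar : IsSkeleton edgeStar ({0, ue 0} : Finset (Fin 4 → ℤ)) := by
  classical
  refine ⟨⟨0, by simp, ?_⟩, ?_⟩
  · refine ⟨by simp, fun b hb => ?_⟩
    rcases Finset.mem_insert.1 hb with rfl | hb
    · exact Polymer.Reach.refl _
    · rw [Finset.mem_singleton.1 hb]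
      refine Polymer.Reach.single (by simp) (by simp) ?_
      refine ⟨0, Finset.mem_union_left _ (mem_cubesAt_of_isCorner (isCorner_self 0)), ∅, 0,
        Finset.notMem_empty _, Or.inl ⟨by simp, ?_⟩⟩
      rw [Finset.insert_empty, cornerVec_singleton, zero_add]; rfl
  · intro m hm
    rcases Finset.mem_union.1 hm with hm | hm
    · exact ⟨0, by simp, isCorner_of_mem_cubesAt hm⟩
    · exact ⟨ue 0, by simp, isCorner_of_mem_cubesAt hm⟩

/-- hence `d(edgeStar) ≤ 1`. [folklore] -/
theorem linSize_edgeStar_le_one : linSize edgeStar ≤ 1 := by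
  have := linSize_le_card_sub_one_of_isSkeleton isSkeleton_edgeStar
  have hcard : ({0, ue 0} : Finset (Fin 4 → ℤ)).card = 2 := by decide
  omega

/-- **SHARPNESS: `d(edgeStar) = 1` and `#edgeStar = 24 = 16 + 8·d = 3·2³·d`** — the sharp count itself forces `d ≥ 1`
(`24 ≤ 16 + 8d`), so both `card_le_two_pow_add_mul_linSize` and the printed constant `3·2³` of (2.30) are attained.
[cite: Balaban1988RG2Cluster, (2.30) p.18] -/
theorem linSize_edgeStar : linSize edgeStar = 1 := by
  have h1 := linSize_edgeStar_le_one
  have h2 := card_le_sixteen_add_eight_mul ⟨_, isSkeleton_edgeStar⟩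
  rw [card_edgeStar] at h2
  omega

/-- the printed constant is attained: `#edgeStar = 3·2³·d(edgeStar)`. [cite: Balaban1988RG2Cluster, (2.30) p.18] -/
theorem card_edgeStar_eq : edgeStar.card = 3 * 2 ^ 3 * linSize edgeStar := by
  rw [card_edgeStar, linSize_edgeStar]; norm_num

end Sharp

end Literature.MathematicalPhysics.QuantumFieldTheory.Balaban1983to89.T4LinearSizeSharpLower
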